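import Summits.KontsevichZagierPeriods.KontsevichZagierPeriods.Theorems.RootDecompWalshStrataPiFourRung
import Summits.KontsevichZagierPeriods.KontsevichZagierPeriods.Theorems.RootDecompWalshStrataSplit4Euler
import Summits.KontsevichZagierPeriods.KontsevichZagierPeriods.Theorems.RootDecompWalshStrataSplit4Rung
import Summits.KontsevichZagierPeriods.KontsevichZagierPeriods.Theorems.SoloInformedPiDisc
import Summits.KontsevichZagierPeriods.KontsevichZagierPeriods.Theorems.SoloInformedTorsionFree

/-!
# The `Π`-rung for the fourth genus: the split quadric modulo Euler's `6ζ(2) = π²`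

Route `RootDecompWalshStrata` (cell decomp-kz, lens 4, gen 12), support toward `QuadricSignKernel`
(item stmt-KontsevichZagierPeriods-25393), slice `d = 4`.

`Split4Euler` proved, inside the three rules and unconditionally,
`[(0,1)⁴ ∩ {x₀x₁ + x₂x₃ > 1}, q] ≡ [zRep (q/2)] + [pt, −3q/4]` (Beukers' `ζ(2)`-square plus a
rational point).  Consequences recorded here:

* UNCONDITIONAL: the split quadric is in the class of the sector `Π_Z = Π ∪ {[zRep c]}`
  (`piZDescentAt_split4`); its values lie in `ℚ + ℚπ²`, so transcendence of `π` decides nothing new —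
  what the kernel of `Π_Z` needs beyond `piKernel` is exactly ONE relation, Euler's theorem in KZ form.
* `EulerKZ : 6·[zRep 1] − [π]·[π] ∈ KZ.relations` — the TEXTUAL TWIN of the tree theorem
  `soloInformed_six_zetaTwo_sub_pi_mul_pi_mem_relations` (Theorems/SoloInformedZetaTwo.lean, sorry-free
  in the tree, module not built on the farm at the time of writing) with its representation
  `soloInformedZetaTwoRep = [soloInformedOpenSq, 1/(1 − z₀z₁)]` replaced by our `zRep 1 =
  [sqSet, (1:ℚ)/(1 − z₀z₁)]` (same set `(0,1)²`, same function): DISCHARGE BY NAME on landing via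
  `KZ.of_sub_of_mem_relations_of_eqOn` + `AddSubgroup.nsmul_mem`.  It is used as a named hypothesis,
  never as an axiom.
* Under `EulerKZ`: `[zRep c] ≡ [hq2Rep (8c/3)]` (`of_zRep_sub_of_hq2Rep_mem_relations`, through the
  tree's `[π] ≡ 4·[arctan]`, the product rule, scaling and torsion-freeness — all by name), hence the
  split quadric is in the `Π`-class (`piDescentAt_split4_of_eulerKZ`) and **Conjecture 1 in kernel form
  holds for every mixed family drawn from the orbits of ALL FOUR uncut `d = 4` specimens — ball, split,
  paraboloid, cone** (`sum_mem_relations_fourGenera_of_eulerKZ`), the only input beyond the three rules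
  and Lindemann being Euler's identity as a KZ-relation (a tree theorem).
0 sorry.  [KontsevichZagier2001 §1.2, §4.1; Beukers1979 §2; Lindemann1882; this node]
-/

noncomputable section

open Literature.NumberTheory.Transcendental
open MeasureTheory Set
open MvPolynomial (aeval X C rename bind₁)
open Summit.KontsevichZagierPeriods.RootDecompWalshStrata.WalshSpanProof (cellRep)
open Summit.KontsevichZagierPeriods.RootDecompWalshStrata.QuadricFourRung (totalDegree_ball4Poly_le
  totalDegree_parab4Poly_le totalDegree_cone4Poly_le totalDegree_split4Poly_le)
open Summit.KontsevichZagierPeriods.RootDecompWalshStrata.Ball4 (ball4Poly ivSet isSemialgebraic_ivSet)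
open Summit.KontsevichZagierPeriods.RootDecompWalshStrata.Parab4 (parab4Poly)
open Summit.KontsevichZagierPeriods.RootDecompWalshStrata.Cone4 (cone4Poly)
open Summit.KontsevichZagierPeriods.RootDecompWalshStrata.Split4 (split4Poly)
open Summit.KontsevichZagierPeriods.RootDecompWalshStrata.PiSector (piGens piKernel cstRep hqRep hq2Rep hqRep_domain hqRep_integrand hq2Rep_integrand of_hqRep_mul_of_hqRep of_cstRep_mem_piGens of_hq2Rep_mem_piGens of_hq2Rep_add of_hq2Rep_zero_mem)
open Summit.KontsevichZagierPeriods.RootDecompWalshStrata.Split4Pi (zRep zRep_domain zRep_integrand of_split4_cell_sub_mem_relations)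
open Summit.KontsevichZagierPeriods.RootDecompWalshStrata.DecompTwo (bakerGens)
open Summit.KontsevichZagierPeriods.KontsevichZagierPeriods.Theorems (soloInformedArctanRep
  soloInformedArctanRep_domain soloInformedArctanRep_integrand soloInformedUnitI
  soloInformed_piRep_sub_four_nsmul_arctanRep_mem_relations soloInformed_mem_relations_of_nsmul_mem)

namespace Summit.KontsevichZagierPeriods.RootDecompWalshStrata.PiAt

open Literature.NumberTheory.Transcendental in
open MeasureTheory Set in
open MvPolynomial (aeval X C) in
open Literature.ModelTheory.ExponentialFields (IsSemialgebraic isSemialgebraic_univ) in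
open Summit.KontsevichZagierPeriods.RootDecompWalshStrata.Ball4 (ivSet isSemialgebraic_ivSet ivSet_subset_Icc sqSet isSemialgebraic_sqSet sqSet_subset_Icc) in
open Summit.KontsevichZagierPeriods.RootDecompWalshStrata.Split4 (triSet triRep triRep_domain triRep_integrand mem_triSet isSemialgebraic_triSet triSet_subset_Icc integrableOn_of_bdd split4Poly of_cell_sub_of_triRep_mem_relations) in
open Summit.KontsevichZagierPeriods.RootDecompWalshStrata.PiSector (cstRep cstRep_domain cstRep_integrand of_cstRep_add) in
open Summit.KontsevichZagierPeriods.RootDecompWalshStrata.WalshSpanProof (cellRep) in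
/-- Membership in `(0,1) ⊆ ℝ¹`. [definition] -/
private theorem mem_ivSet_iff {t : Fin 1 → ℝ} : t ∈ ivSet ↔ 0 < t 0 ∧ t 0 < 1 := by
  simp [ivSet, Fin.forall_fin_one]

open Literature.NumberTheory.Transcendental in
open MeasureTheory Set in
open MvPolynomial (aeval X C) in
open Literature.ModelTheory.ExponentialFields (IsSemialgebraic isSemialgebraic_setOf_eval_pos isSemialgebraic_setOf_eval_eq_zero) in
open Summit.KontsevichZagierPeriods.RootDecompWalshStrata.Ball4 (ivSet isSemialgebraic_ivSet ivSet_subset_Icc arcRep arcRep_domain arcRep_integrand) in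
/-- Points of `ℝ¹` are null. [folklore] -/
private theorem volume_pt1 (a : ℝ) : volume {x : Fin 1 → ℝ | x 0 = a} = 0 := by
  have e : {x : Fin 1 → ℝ | x 0 = a} = Set.pi univ fun _ => {a} := by
    ext x; simp [Fin.forall_fin_one]
  rw [e, volume_pi_pi]; simp

open Literature.NumberTheory.Transcendental in
open MeasureTheory Set in
open MvPolynomial (aeval X C) in
open Literature.ModelTheory.ExponentialFields (IsSemialgebraic) in
open Summit.KontsevichZagierPeriods.RootDecompWalshStrata.Ball4 (ivSet isSemialgebraic_ivSet ivSet_subset_Icc) in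
open Summit.KontsevichZagierPeriods.KontsevichZagierPeriods.Theorems.RootDecompQuadraticDescentLegendre (I1 measurableSet_I1 setIntegral_I1 integrableOn_I1_of integrableOn_Ioo_of_continuous) in
/-- A rational number is algebraic over `ℚ` (as a real number). [folklore] -/
private theorem isAlgebraic_rat (q : ℚ) : IsAlgebraic ℚ ((q : ℚ) : ℝ) := by
  simpa using isAlgebraic_algebraMap (R := ℚ) (A := ℝ) q

/-! #### Sector bridges: descent classes are transitive along relations -/

/-- **Transitivity of descent along a sector bridge:** if every generator of `S` is equivalent modulo
`KZ.relations` to an element of the span of `T`, the `S`-class is contained in the `T`-class.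
[KontsevichZagier2001 §1.2] -/
theorem descentAt_of_bridge {S T : Set KZ.FormalRep}
    (hST : ∀ s ∈ S, ∃ t ∈ AddSubgroup.closure T, s - t ∈ KZ.relations) {d : ℕ}
    {P : MvPolynomial (Fin d) ℚ} (h : QuadricDescentAt S P) : QuadricDescentAt T P := by
  have key : ∀ y ∈ AddSubgroup.closure S, ∃ t ∈ AddSubgroup.closure T, y - t ∈ KZ.relations := by
    intro y hy
    induction hy using AddSubgroup.closure_induction with
    | mem s hs => exact hST s hs
    | zero => exact ⟨0, zero_mem _, by rw [sub_zero]; exact zero_mem _⟩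
    | add y z _ _ hy hz =>
      obtain ⟨t₁, ht₁, h₁⟩ := hy
      obtain ⟨t₂, ht₂, h₂⟩ := hz
      refine ⟨t₁ + t₂, add_mem ht₁ ht₂, ?_⟩
      have : y + z - (t₁ + t₂) = (y - t₁) + (z - t₂) := by abel
      rw [this]
      exact add_mem h₁ h₂
    | neg y _ hy =>
      obtain ⟨t, ht, h⟩ := hy
      refine ⟨-t, neg_mem ht, ?_⟩
      have : -y - -t = -(y - t) := by abel
      rw [this]
      exact neg_mem h
  intro q ρ hρ hdeg
  obtain ⟨y, hy, hrel⟩ := h q ρ hρ hdeg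
  obtain ⟨t, ht, hyt⟩ := key y hy
  refine ⟨t, ht, ?_⟩
  have : KZ.of ρ - t = (KZ.of ρ - y) + (y - t) := by abel
  rw [this]
  exact add_mem hrel hyt

/-! #### Unconditional: the split quadric is in the class of `Π_Z = Π ∪ {[zRep c]}` -/

/-- **`Π_Z`** — the `Π` generators together with Beukers' squares `[zRep c]` (values `ℚ + ℚπ + ℚπ²`,
with `ζ(2) = π²/6` represented twice). [this node] -/
def piZGens : Set KZ.FormalRep := piGens ∪ Set.range fun c : ℚ => KZ.of (zRep c)

/-- **The split quadric `x₀x₁ + x₂x₃ > 1` is in the `Π_Z`-class, UNCONDITIONALLY** (the whole chain of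
gens 10–12 inside the three rules: `[cell, q] ≡ [zRep (q/2)] + [pt, −3q/4]`).
[KontsevichZagier2001 §1.2; Beukers1979 §2; this node] -/
theorem piZDescentAt_split4 : QuadricDescentAt piZGens split4Poly :=
  descentAt_of_cellRep fun _ q =>
    ⟨KZ.of (zRep (q / 2)) + KZ.of (cstRep (-(3 * q) / 4)),
      add_mem (AddSubgroup.subset_closure (Or.inr ⟨q / 2, rfl⟩))
        (AddSubgroup.subset_closure (Or.inl (of_cstRep_mem_piGens _))),
      of_split4_cell_sub_mem_relations q⟩

/-! #### Euler's identity as a KZ-relation (named hypothesis = textual twin of a tree theorem) -/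

/-- **`EulerKZ`: `6·[(0,1)², 1/(1−xy)] − [π]·[π] ∈ KZ.relations`** — Euler's `6ζ(2) = π²` as an
identity of the three rules.  This is the statement of the TREE THEOREM
`soloInformed_six_zetaTwo_sub_pi_mul_pi_mem_relations` (Theorems/SoloInformedZetaTwo.lean l.152) with
`soloInformedZetaTwoRep` replaced by the extensionally equal `zRep 1` (domain `(0,1)²`, integrand
`1/(1 − z₀z₁)`); discharge by name (`KZ.of_sub_of_mem_relations_of_eqOn`) once that module is built on
the checking farm (done in `RootDecompWalshStrataSplit4EulerDischarge`, theorem `eulerKZ`).  Tagged as an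
OBLIGATION NODE (provable by name), never a vendored fact; used below ONLY as a hypothesis.
[Euler1735; KontsevichZagier2001 §1.2; tree SoloInformedZetaTwo] -/
@[conjecture] def EulerKZ : Prop := 6 • KZ.of (zRep 1) - KZ.of KZ.piRep * KZ.of KZ.piRep ∈ KZ.relations

/-- The tree's arctangent representation `[[0,1], 1/(1+x²)]` and our `hqRep 1 = [(0,1), 1/(1+t²)]` are
equivalent (rule (1a): the endpoints are null). [KontsevichZagier2001 §1.2 rule (1)] -/
theorem of_arctanRep_sub_of_hqRep_mem_relations :
    KZ.of soloInformedArctanRep - KZ.of (hqRep 1) ∈ KZ.relations := by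
  have hsub : ivSet ⊆ soloInformedArctanRep.domain := fun t ht => by
    rw [soloInformedArctanRep_domain, soloInformedUnitI]
    exact ⟨(mem_ivSet_iff.1 ht).1.le, (mem_ivSet_iff.1 ht).2.le⟩
  have hnull : volume (soloInformedArctanRep.domain \ ivSet) = 0 := by
    have hcov : soloInformedArctanRep.domain \ ivSet ⊆
        {x : Fin 1 → ℝ | x 0 = 0} ∪ {x : Fin 1 → ℝ | x 0 = 1} := by
      intro x hx
      rw [soloInformedArctanRep_domain, soloInformedUnitI] at hx
      obtain ⟨⟨h0, h1⟩, hn⟩ := hx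
      rw [mem_ivSet_iff, not_and_or, not_lt, not_lt] at hn
      rcases hn with hn | hn
      · exact Or.inl (le_antisymm hn h0)
      · exact Or.inr (le_antisymm h1 hn)
    exact measure_mono_null hcov (measure_union_null (volume_pt1 0) (volume_pt1 1))
  have h1 := soloInformedArctanRep.of_sub_of_restrict_mem_relations isSemialgebraic_ivSet hsub hnull
  have h2 : KZ.of (soloInformedArctanRep.restrict ivSet isSemialgebraic_ivSet hsub) - KZ.of (hqRep 1) ∈
      KZ.relations := by
    refine KZ.of_sub_of_mem_relations_of_eqOn rfl fun t _ => ?_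
    rw [KZ.IntegralRep.integrand_restrict, soloInformedArctanRep_integrand, hqRep_integrand]
    push_cast
    rfl
  have : KZ.of soloInformedArctanRep - KZ.of (hqRep 1) =
      (KZ.of soloInformedArctanRep - KZ.of (soloInformedArctanRep.restrict ivSet isSemialgebraic_ivSet hsub))
        + (KZ.of (soloInformedArctanRep.restrict ivSet isSemialgebraic_ivSet hsub) - KZ.of (hqRep 1)) := by
    abel
  rw [this]
  exact add_mem h1 h2

/-- **`[π] ≡ 4·[hqRep 1]`** (tree: `[π] ≡ 4·[arctan]`, four quarter-windings of the disc).
[KontsevichZagier2001 §1.1–1.2; tree SoloInformedPiDisc] -/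
theorem of_piRep_sub_nsmul_of_hqRep_mem_relations :
    KZ.of KZ.piRep - 4 • KZ.of (hqRep 1) ∈ KZ.relations := by
  have h1 := soloInformed_piRep_sub_four_nsmul_arctanRep_mem_relations
  have h2 := AddSubgroup.nsmul_mem KZ.relations of_arctanRep_sub_of_hqRep_mem_relations 4
  have : KZ.of KZ.piRep - 4 • KZ.of (hqRep 1) =
      (KZ.of KZ.piRep - 4 • KZ.of soloInformedArctanRep) +
        4 • (KZ.of soloInformedArctanRep - KZ.of (hqRep 1)) := by
    rw [smul_sub]; abel
  rw [this]
  exact add_mem h1 h2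

/-- `(4·x)(4·y) = 16·(xy)` in the formal ring. [folklore] -/
theorem four_nsmul_mul_four_nsmul (x y : KZ.FormalRep) : (4 • x) * (4 • y) = 16 • (x * y) := by
  rw [smul_mul_assoc, mul_smul_comm, smul_smul]
  norm_num

/-- **`[π]·[π] ≡ 16·[hq2Rep 1]`** (product rule). [KontsevichZagier2001 §1.2; this node] -/
theorem piRep_mul_piRep_sub_mem_relations :
    KZ.of KZ.piRep * KZ.of KZ.piRep - 16 • KZ.of (hq2Rep 1) ∈ KZ.relations := by
  have h := KZ.mul_sub_mul_mem_relations of_piRep_sub_nsmul_of_hqRep_mem_relations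
    of_piRep_sub_nsmul_of_hqRep_mem_relations
  rwa [four_nsmul_mul_four_nsmul, of_hqRep_mul_of_hqRep] at h

/-- Scaling Beukers' square: `(zRep 1).constMul c ≡ zRep c`. [KontsevichZagier2001 §1.2] -/
theorem of_constMul_zRep_sub_mem_relations (c : ℚ) :
    KZ.of ((zRep 1).constMul (c : ℝ) (isAlgebraic_rat c)) - KZ.of (zRep c) ∈ KZ.relations := by
  refine KZ.of_sub_of_mem_relations_of_eqOn rfl fun z _ => ?_
  change ((c : ℝ) * (zRep 1).integrand z) = (zRep c).integrand z
  rw [zRep_integrand, zRep_integrand]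
  push_cast
  ring

/-- Scaling the squared arc: `(hq2Rep 1).constMul c ≡ hq2Rep c`. [KontsevichZagier2001 §1.2] -/
theorem of_constMul_hq2Rep_sub_mem_relations (c : ℚ) :
    KZ.of ((hq2Rep 1).constMul (c : ℝ) (isAlgebraic_rat c)) - KZ.of (hq2Rep c) ∈ KZ.relations := by
  refine KZ.of_sub_of_mem_relations_of_eqOn rfl fun z _ => ?_
  change ((c : ℝ) * (hq2Rep 1).integrand z) = (hq2Rep c).integrand z
  rw [hq2Rep_integrand, hq2Rep_integrand]
  push_cast
  ring

/-- Multiples of squared arcs: `n·[hq2Rep c] ≡ [hq2Rep (n·c)]` (additivity). [KontsevichZagier2001 §1.2 rule (1)] -/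
theorem nsmul_of_hq2Rep_sub_mem_relations (n : ℕ) (c : ℚ) :
    n • KZ.of (hq2Rep c) - KZ.of (hq2Rep (n * c)) ∈ KZ.relations := by
  induction n with
  | zero => simpa using neg_mem of_hq2Rep_zero_mem
  | succ n ih =>
    have h := of_hq2Rep_add (n * c) c
    have e : ((n + 1 : ℕ) : ℚ) * c = n * c + c := by push_cast; ring
    rw [e, succ_nsmul]
    have : n • KZ.of (hq2Rep c) + KZ.of (hq2Rep c) - KZ.of (hq2Rep (n * c + c)) =
        (n • KZ.of (hq2Rep c) - KZ.of (hq2Rep (n * c))) -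
          (KZ.of (hq2Rep (n * c + c)) - KZ.of (hq2Rep (n * c)) - KZ.of (hq2Rep c)) := by abel
    rw [this]
    exact sub_mem ih h

/-- **Under `EulerKZ`: `[zRep c] ≡ [hq2Rep (8c/3)]`** — Beukers' square with weight `c` (value `cπ²/6`)
joins the `Π`-sector (scaling by `c`, `[π]·[π] ≡ 16·[hq2Rep 1]`, additivity, torsion-freeness of
`𝓟/relations` — every input a tree theorem by name). [Euler1735; KontsevichZagier2001 §1.2; this node] -/
theorem of_zRep_sub_of_hq2Rep_mem_relations (hE : EulerKZ) (c : ℚ) :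
    KZ.of (zRep c) - KZ.of (hq2Rep (8 * c / 3)) ∈ KZ.relations := by
  -- `6·[zRep 1] ≡ 16·[hq2Rep 1]`
  have h1 : 6 • KZ.of (zRep 1) - 16 • KZ.of (hq2Rep 1) ∈ KZ.relations := by
    have : 6 • KZ.of (zRep 1) - 16 • KZ.of (hq2Rep 1) =
        (6 • KZ.of (zRep 1) - KZ.of KZ.piRep * KZ.of KZ.piRep) +
          (KZ.of KZ.piRep * KZ.of KZ.piRep - 16 • KZ.of (hq2Rep 1)) := by abel
    rw [this]
    exact add_mem hE piRep_mul_piRep_sub_mem_relations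
  -- scale by `c`: `6·[zRep c] ≡ 16·[hq2Rep c]`
  have h2 : 6 • KZ.of (zRep c) - 16 • KZ.of (hq2Rep c) ∈ KZ.relations := by
    have hs := KZ.scale_mem_relations (c : ℝ) (isAlgebraic_rat c) h1
    rw [map_sub, map_nsmul, map_nsmul, KZ.scale_of, KZ.scale_of] at hs
    have ha := AddSubgroup.nsmul_mem KZ.relations (of_constMul_zRep_sub_mem_relations c) 6
    have hb := AddSubgroup.nsmul_mem KZ.relations (of_constMul_hq2Rep_sub_mem_relations c) 16
    rw [smul_sub] at ha hb
    have : 6 • KZ.of (zRep c) - 16 • KZ.of (hq2Rep c) =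
        (6 • KZ.of ((zRep 1).constMul (c : ℝ) (isAlgebraic_rat c)) -
          16 • KZ.of ((hq2Rep 1).constMul (c : ℝ) (isAlgebraic_rat c))) -
        (6 • KZ.of ((zRep 1).constMul (c : ℝ) (isAlgebraic_rat c)) - 6 • KZ.of (zRep c)) +
        (16 • KZ.of ((hq2Rep 1).constMul (c : ℝ) (isAlgebraic_rat c)) - 16 • KZ.of (hq2Rep c)) := by
      abel
    rw [this]
    exact add_mem (sub_mem hs ha) hb
  -- `16·[hq2Rep c] ≡ [hq2Rep (16c)] ≡ 6·[hq2Rep (8c/3)]`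
  have h3 := nsmul_of_hq2Rep_sub_mem_relations 16 c
  have h4 := nsmul_of_hq2Rep_sub_mem_relations 6 (8 * c / 3)
  have e : ((6 : ℕ) : ℚ) * (8 * c / 3) = ((16 : ℕ) : ℚ) * c := by push_cast; ring
  rw [e] at h4
  have h6 : 6 • (KZ.of (zRep c) - KZ.of (hq2Rep (8 * c / 3))) ∈ KZ.relations := by
    have : 6 • (KZ.of (zRep c) - KZ.of (hq2Rep (8 * c / 3))) =
        (6 • KZ.of (zRep c) - 16 • KZ.of (hq2Rep c)) +
          (16 • KZ.of (hq2Rep c) - KZ.of (hq2Rep (((16 : ℕ) : ℚ) * c))) -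
            (6 • KZ.of (hq2Rep (8 * c / 3)) - KZ.of (hq2Rep (((16 : ℕ) : ℚ) * c))) := by
      rw [smul_sub]; abel
    rw [this]
    exact sub_mem (add_mem h2 h3) h4
  exact soloInformed_mem_relations_of_nsmul_mem (by norm_num) h6

/-- Under `EulerKZ` every generator of `Π_Z` is equivalent to an element of the span of `Π`. [this node] -/
theorem piZ_bridge (hE : EulerKZ) :
    ∀ s ∈ piZGens, ∃ t ∈ AddSubgroup.closure piGens, s - t ∈ KZ.relations := by
  rintro s (hs | ⟨c, rfl⟩)
  · exact ⟨s, AddSubgroup.subset_closure hs, by rw [sub_self]; exact zero_mem _⟩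
  · exact ⟨KZ.of (hq2Rep (8 * c / 3)), AddSubgroup.subset_closure (of_hq2Rep_mem_piGens _),
      of_zRep_sub_of_hq2Rep_mem_relations hE c⟩

/-- **The split quadric is in the `Π`-class, given Euler's identity as a KZ-relation.**
[Euler1735; KontsevichZagier2001 §1.2; this node] -/
theorem piDescentAt_split4_of_eulerKZ (hE : EulerKZ) : QuadricDescentAt piGens split4Poly :=
  descentAt_of_bridge (piZ_bridge hE) piZDescentAt_split4

/-- Orbit variant (coordinate permutation after a box reflection). [KontsevichZagier2001 §1.2 rule (2)] -/
theorem piDescentAt_split4_rename_reflect (hE : EulerKZ) (σ : Equiv.Perm (Fin 4)) (j : Fin 4) :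
    QuadricDescentAt piGens (rename σ (bind₁ (KZ.reflectSubst j) split4Poly)) :=
  descentAt_rename_reflect σ j totalDegree_split4Poly_le (piDescentAt_split4_of_eulerKZ hE)
/-- Orbit variant (coordinate permutation). [KontsevichZagier2001 §1.2 rule (2)] -/
theorem piDescentAt_split4_rename (hE : EulerKZ) (σ : Equiv.Perm (Fin 4)) :
    QuadricDescentAt piGens (rename σ split4Poly) :=
  descentAt_rename σ (piDescentAt_split4_of_eulerKZ hE)

/-- **Conjecture 1 (kernel form) for every MIXED family of constant-weight 4-cells drawn from the
orbits (coordinate permutations of box reflections) of ALL FOUR uncut specimens — the BALL `Σxᵢ² < 1`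
and the SPLIT quadric `x₀x₁ + x₂x₃ > 1` (weight two: `π²`, `ζ(2)`), the PARABOLOID and the CONE
(weight one: `π`) — given only Euler's `6ζ(2) = π²` as a KZ-relation (`EulerKZ`, a tree theorem by
name).**  Without the split genus the statement is unconditional (`sum_mem_relations_ball4_parab4_cone4`).
[Lindemann1882; Euler1735; KontsevichZagier2001 §1.2, §4.1; this node] -/
theorem sum_mem_relations_fourGenera_of_eulerKZ (hE : EulerKZ) (k : ℕ)
    (P : Fin k → MvPolynomial (Fin 4) ℚ) (q : Fin k → ℚ) (ρ : Fin k → KZ.IntegralRep 4) (c : Fin k → ℤ)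
    (hP : ∀ i, ∃ (σ : Equiv.Perm (Fin 4)) (j : Fin 4) (Q : MvPolynomial (Fin 4) ℚ),
      (Q = ball4Poly ∨ Q = split4Poly ∨ Q = parab4Poly ∨ Q = cone4Poly) ∧
      (P i = rename σ Q ∨ P i = rename σ (bind₁ (KZ.reflectSubst j) Q)))
    (hρ : ∀ i, (ρ i).domain = {x | (∀ j, 0 < x j ∧ x j < 1) ∧ 0 < MvPolynomial.aeval x (P i)} ∧
      ∀ x ∈ (ρ i).domain, (ρ i).integrand x = (q i : ℝ))
    (hv : KZ.eval (∑ i, c i • KZ.of (ρ i)) = 0) : (∑ i, c i • KZ.of (ρ i)) ∈ KZ.relations := by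
  have hQ : ∀ Q : MvPolynomial (Fin 4) ℚ,
      (Q = ball4Poly ∨ Q = split4Poly ∨ Q = parab4Poly ∨ Q = cone4Poly) →
      Q.totalDegree ≤ 2 ∧ QuadricDescentAt piGens Q := by
    rintro Q (rfl | rfl | rfl | rfl)
    · exact ⟨totalDegree_ball4Poly_le, piDescentAt_ball4⟩
    · exact ⟨totalDegree_split4Poly_le, piDescentAt_split4_of_eulerKZ hE⟩
    · exact ⟨totalDegree_parab4Poly_le, piDescentAt_parab4⟩
    · exact ⟨totalDegree_cone4Poly_le, piDescentAt_cone4⟩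
  refine sum_mem_relations_pi k (fun _ => 4) P q ρ c (fun i => ?_) hρ (fun i => ?_) hv
  · obtain ⟨σ, j, Q, hQ4, h | h⟩ := hP i <;> rw [h]
    · exact descentAt_rename σ (hQ Q hQ4).2
    · exact descentAt_rename_reflect σ j (hQ Q hQ4).1 (hQ Q hQ4).2
  · obtain ⟨σ, j, Q, hQ4, h | h⟩ := hP i <;> rw [h] <;>
      refine (MvPolynomial.totalDegree_rename_le _ _).trans ?_
    · exact (hQ Q hQ4).1
    · exact (totalDegree_reflect_le j Q).trans (hQ Q hQ4).1

/-- **The split family alone, given `EulerKZ`:** Conjecture 1 (kernel form) for every family of split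
cells `[(0,1)⁴ ∩ {x₀x₁ + x₂x₃ > 1}, qᵢ]`. [Euler1735; KontsevichZagier2001 §1.2; this node] -/
theorem sum_mem_relations_split4_of_eulerKZ (hE : EulerKZ) (k : ℕ) (q : Fin k → ℚ)
    (ρ : Fin k → KZ.IntegralRep 4) (c : Fin k → ℤ)
    (hρ : ∀ i, (ρ i).domain = {x | (∀ j, 0 < x j ∧ x j < 1) ∧ 0 < MvPolynomial.aeval x split4Poly} ∧
      ∀ x ∈ (ρ i).domain, (ρ i).integrand x = (q i : ℝ))
    (hv : KZ.eval (∑ i, c i • KZ.of (ρ i)) = 0) : (∑ i, c i • KZ.of (ρ i)) ∈ KZ.relations :=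
  sum_mem_relations_pi k (fun _ => 4) (fun _ => split4Poly) q ρ c
    (fun _ => piDescentAt_split4_of_eulerKZ hE) hρ (fun _ => totalDegree_split4Poly_le) hv

/-- The split quadric is in the joint `B ∪ Π`-class given `EulerKZ` (for `quadricFour_of_jointKernel`).
[this node] -/
theorem jointDescentAt_split4_of_eulerKZ (hE : EulerKZ) : QuadricDescentAt (bakerGens ∪ piGens) split4Poly :=
  jointDescentAt_of_piDescentAt (piDescentAt_split4_of_eulerKZ hE)

end Summit.KontsevichZagierPeriods.RootDecompWalshStrata.PiAt

end
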